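import Summits.ResolutionOfSingularities.ResolutionOfSingularities.Theorems.FrobeniusLadderFInjectiveMacaulayficationWeightCoaction
import Summits.ResolutionOfSingularities.ResolutionOfSingularities.Theorems.FrobeniusLadderFInjectiveMacaulayficationSubalgebraIntegralOfPow
import Mathlib.Data.ZMod.Basic
import HarnessLib

/-!
# The Veronese subalgebra `A' ⊆ L[s]` of the graded engine (crux `FInjectiveMacaulayfication`, §16 H-G2b)

Support file for crux stmt-ResolutionOfSingularities-15315 (`FrobeniusLadder.FInjectiveMacaulayfication`), §16 THE
GRADED ENGINE (CRUX-PLAN w45a v3, line `graded-engine`, registered stub G4 `stub_gradedChartClause`; lead seat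
res-L1-w45a-lead-1; design memo GRADED-ENGINE.md v2, helper target H-G2 `ReesVeronese`, second part). [OURS · L1 W4.5a]

Setting as in `WeightCoaction`: `R = k[X]/(f)`, `u = ā₀` homogeneous of weight `N > 0`, `L = R[1/u]` with coaction
`λ`, components `(λ x)_m`. Grade `T' = L[s]` by `deg (ℓ sⁱ) = deg ℓ - i`. The `N`-th VERONESE subalgebra
`A' = ⊕_{N ∣ d} T'_d` consists of the polynomials `∑ Pᵢ sⁱ` such that every weight component of `Pᵢ` has degree
`≡ i (mod N)`; membership is phrased through the vanishing of the components `(λ Pᵢ)_m`, `m ≢ i (mod N)`.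
* `coeff_eq_zero_of_isHomogeneous`, `coeff_mul_eq_zero_of_residue` — residue-class bookkeeping of components;
* `exists_veroneseSubalgebra` — `A'` is a `k`-subalgebra of `L[s]`;
* `X_pow_mem_veronese`, `C_mem_veronese_of_isHomogeneous`, `mem_veronese_of_degreeZero` — `s^N ∈ A'`, `u/1, 1/u ∈ A'`,
  and the degree-`0` part `T₀ ≤ A'`;
* `adjoin_generators_eq_top`, `isIntegral_veronese` — `L[s]` is generated over `k` by `s`, `1/u` and the `x̄ⱼ/1`, each
  with its `N`-th power in `A'`, so `L[s]` is integral over `A'` (`SubalgebraIntegralOfPow`, p456170).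
No definitions, no named facts. [folklore]
-/

set_option linter.dupNamespace false

noncomputable section

open LaurentPolynomial

namespace Summit.ResolutionOfSingularities.ResolutionOfSingularities.Theorems.FInjectiveMacaulayfication.VeroneseSubalgebra

open Summit.ResolutionOfSingularities.ResolutionOfSingularities.Theorems.FInjectiveMacaulayfication.WeightCoaction

variable {k : Type} [Field k] {n : ℕ} (w : Fin n → ℕ) (f : MvPolynomial (Fin n) k)
variable (u : MvPolynomial (Fin n) k ⧸ Ideal.span {f}) {N : ℕ} {a₀ : MvPolynomial (Fin n) k}
  (ha₀ : MvPolynomial.IsWeightedHomogeneous w a₀ N) (hu : Ideal.Quotient.mk (Ideal.span {f}) a₀ = u)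
variable (lam : Localization.Away u →+* (Localization.Away u)[T;T⁻¹])
variable (hlam : ∀ a : MvPolynomial (Fin n) k,
        lam (algebraMap (MvPolynomial (Fin n) k ⧸ Ideal.span {f}) _ (Ideal.Quotient.mk (Ideal.span {f}) a)) =
          MvPolynomial.aeval (fun j : Fin n => C (algebraMap (MvPolynomial (Fin n) k ⧸ Ideal.span {f})
            (Localization.Away u) (Ideal.Quotient.mk (Ideal.span {f}) (MvPolynomial.X j))) * T (w j : ℤ)) a)

/-! ## Residue classes of components -/

/-- Components of sums. [folklore] -/
theorem coeff_map_sum {ι : Type} (s : Finset ι) (g : ι → Localization.Away u) (m : ℤ) :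
    (lam (∑ i ∈ s, g i)).coeff m = ∑ i ∈ s, (lam (g i)).coeff m := by
  classical
  induction s using Finset.induction_on with
  | empty => simp
  | insert a s ha ih => rw [Finset.sum_insert ha, Finset.sum_insert ha, map_add, AddMonoidAlgebra.coeff_add,
      Finsupp.add_apply, ih]

/-- A homogeneous element of degree `d` has no components in degrees `≢ d (mod N)`. [folklore] -/
theorem coeff_eq_zero_of_isHomogeneous (N' : ℕ) {x : Localization.Away u} {d : ℤ} (hx : lam x = C x * T d)
    (m : ℤ) (hm : (m : ZMod N') ≠ (d : ZMod N')) : (lam x).coeff m = 0 := by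
  rw [coeff_of_isHomogeneous f u lam hx, if_neg]
  rintro rfl
  exact hm rfl

section
include ha₀ hu hlam

/-- **Residue classes multiply**: if the components of `x` live in degrees `≡ r` and those of `y` in degrees `≡ r'`
(mod `N`), then those of `x y` live in degrees `≡ r + r'`. [folklore] -/
theorem coeff_mul_eq_zero_of_residue (N' : ℕ) {x y : Localization.Away u} {r r' : ZMod N'}
    (hx : ∀ m : ℤ, (m : ZMod N') ≠ r → (lam x).coeff m = 0) (hy : ∀ m : ℤ, (m : ZMod N') ≠ r' → (lam y).coeff m = 0)
    (m : ℤ) (hm : (m : ZMod N') ≠ r + r') : (lam (x * y)).coeff m = 0 := by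
  classical
  rw [eq_sum_coeff w f u lam hlam x, eq_sum_coeff w f u lam hlam y, Finset.sum_mul_sum, coeff_map_sum]
  refine Finset.sum_eq_zero fun a _ => ?_
  rw [coeff_map_sum]
  refine Finset.sum_eq_zero fun b _ => ?_
  have hab := isHomogeneous_mul f u lam (coaction_coeff w f u ha₀ hu lam hlam x a) (coaction_coeff w f u ha₀ hu lam hlam y b)
  rw [coeff_of_isHomogeneous f u lam hab]
  split_ifs with h
  · subst h
    by_cases ha : (a : ZMod N') = r
    · by_cases hb : (b : ZMod N') = r'
      · exfalso; apply hm; push_cast; rw [ha, hb]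
      · rw [hy _ hb, mul_zero]
    · rw [hx _ ha, zero_mul]
  · rfl

end

/-! ## The Veronese subalgebra -/

section
include ha₀ hu hlam

/-- **The Veronese subalgebra `A' ⊆ L[s]`**: polynomials `∑ Pᵢ sⁱ` whose coefficient `Pᵢ` has all its weight
components in degrees `≡ i (mod N)` (i.e. total degree `deg Pᵢ - i ∈ Nℤ`). Closed under products by
`coeff_mul_eq_zero_of_residue`; contains the scalars (degree `0`). [folklore] -/
theorem exists_veroneseSubalgebra (N' : ℕ) :
    ∃ A' : Subalgebra k (Polynomial (Localization.Away u)), ∀ P : Polynomial (Localization.Away u),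
      P ∈ A' ↔ ∀ (i : ℕ) (m : ℤ), (m : ZMod N') ≠ (i : ZMod N') → (lam (P.coeff i)).coeff m = 0 := by
  classical
  refine ⟨{ carrier := {P | ∀ (i : ℕ) (m : ℤ), (m : ZMod N') ≠ (i : ZMod N') → (lam (P.coeff i)).coeff m = 0}
            mul_mem' := ?_, one_mem' := ?_, add_mem' := ?_, zero_mem' := ?_, algebraMap_mem' := ?_ },
    fun P => Iff.rfl⟩
  · intro P Q hP hQ i m hm
    rw [Polynomial.coeff_mul, coeff_map_sum]
    refine Finset.sum_eq_zero fun ab hab => ?_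
    rw [Finset.mem_antidiagonal] at hab
    refine coeff_mul_eq_zero_of_residue w f u ha₀ hu lam hlam N' (hP ab.1) (hQ ab.2) m ?_
    rw [← Nat.cast_add, hab]
    exact hm
  · intro i m hm
    simp only [Polynomial.coeff_one]
    split_ifs with h
    · subst h
      refine coeff_eq_zero_of_isHomogeneous f u lam N' (d := 0) (by rw [map_one, map_one, T_zero, mul_one]) m ?_
      simpa using hm
    · rw [map_zero, AddMonoidAlgebra.coeff_zero, Finsupp.zero_apply]
  · intro P Q hP hQ i m hm
    rw [Polynomial.coeff_add, map_add, AddMonoidAlgebra.coeff_add, Finsupp.add_apply, hP i m hm, hQ i m hm, add_zero]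
  · intro i m _
    rw [Polynomial.coeff_zero, map_zero, AddMonoidAlgebra.coeff_zero, Finsupp.zero_apply]
  · intro r i m hm
    simp only [Polynomial.algebraMap_apply, Polynomial.coeff_C]
    split_ifs with h
    · subst h
      refine coeff_eq_zero_of_isHomogeneous f u lam N' (d := 0) ?_ m (by simpa using hm)
      rw [T_zero, mul_one]
      exact coaction_algebraMap w f u lam hlam r
    · rw [map_zero, AddMonoidAlgebra.coeff_zero, Finsupp.zero_apply]

end

variable (N' : ℕ) (A' : Subalgebra k (Polynomial (Localization.Away u)))
  (hA' : ∀ P : Polynomial (Localization.Away u),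
      P ∈ A' ↔ ∀ (i : ℕ) (m : ℤ), (m : ZMod N') ≠ (i : ZMod N') → (lam (P.coeff i)).coeff m = 0)

section
include hA'

/-- `s^N ∈ A'` (and more generally `s^e ∈ A'` whenever `N ∣ e`). [folklore] -/
theorem X_pow_mem_veronese (e : ℕ) (he : (e : ZMod N') = 0) : (Polynomial.X : Polynomial (Localization.Away u)) ^ e ∈ A' := by
  rw [hA']
  intro i m hm
  rw [Polynomial.coeff_X_pow]
  split_ifs with h
  · subst h
    refine coeff_eq_zero_of_isHomogeneous f u lam N' (d := 0) (by rw [map_one, map_one, T_zero, mul_one]) m ?_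
    rw [he] at hm
    simpa using hm
  · rw [map_zero, AddMonoidAlgebra.coeff_zero, Finsupp.zero_apply]

/-- Constants `ℓ ∈ L` homogeneous of degree divisible by `N` lie in `A'`. [folklore] -/
theorem C_mem_veronese_of_isHomogeneous {x : Localization.Away u} {d : ℤ} (hx : lam x = C x * T d) (hd : (d : ZMod N') = 0) :
    Polynomial.C x ∈ A' := by
  rw [hA']
  intro i m hm
  rw [Polynomial.coeff_C]
  split_ifs with h
  · subst h
    refine coeff_eq_zero_of_isHomogeneous f u lam N' hx m ?_
    rw [hd]
    simpa using hm
  · rw [map_zero, AddMonoidAlgebra.coeff_zero, Finsupp.zero_apply]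

/-- The degree-`0` part lies in the Veronese subalgebra: `T₀ ≤ A'`. [folklore] -/
theorem mem_veronese_of_degreeZero {P : Polynomial (Localization.Away u)}
    (hP : ∀ i : ℕ, lam (P.coeff i) = C (P.coeff i) * T (i : ℤ)) : P ∈ A' := by
  rw [hA']
  intro i m hm
  exact coeff_eq_zero_of_isHomogeneous f u lam N' (hP i) m (by simpa using hm)

end

/-! ## Integrality of `L[s]` over `A'` -/

/-- `L[s]` is generated over `k` by `s`, `1/u` and the `x̄ⱼ/1`. [folklore] -/
theorem adjoin_generators_eq_top :
    Algebra.adjoin k ({(Polynomial.X : Polynomial (Localization.Away u)), Polynomial.C (IsLocalization.Away.invSelf u)} ∪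
      Set.range (fun j : Fin n => Polynomial.C (algebraMap _ (Localization.Away u)
        (Ideal.Quotient.mk (Ideal.span {f}) (MvPolynomial.X j))))) = ⊤ := by
  classical
  set B := Algebra.adjoin k ({(Polynomial.X : Polynomial (Localization.Away u)), Polynomial.C (IsLocalization.Away.invSelf u)} ∪
      Set.range (fun j : Fin n => Polynomial.C (algebraMap _ (Localization.Away u)
        (Ideal.Quotient.mk (Ideal.span {f}) (MvPolynomial.X j))))) with hB
  have hX : (Polynomial.X : Polynomial (Localization.Away u)) ∈ B := Algebra.subset_adjoin (Or.inl (Or.inl rfl))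
  have hinv : Polynomial.C (IsLocalization.Away.invSelf u) ∈ B := Algebra.subset_adjoin (Or.inl (Or.inr rfl))
  have hx : ∀ j : Fin n, Polynomial.C (algebraMap _ (Localization.Away u)
      (Ideal.Quotient.mk (Ideal.span {f}) (MvPolynomial.X j))) ∈ B := fun j => Algebra.subset_adjoin (Or.inr ⟨j, rfl⟩)
  -- all constants
  have hC : ∀ x : Localization.Away u, Polynomial.C x ∈ B := by
    intro x
    refine away_induction f u (P := fun x => Polynomial.C x ∈ B) (by rw [map_zero]; exact B.zero_mem)
      (fun x y hx' hy' => by rw [map_add]; exact B.add_mem hx' hy') (fun b r j => ?_) x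
    rw [map_mul, map_pow, MvPolynomial.monomial_eq, map_mul, map_mul, map_mul, algebraMap_mk_C, Finsupp.prod, map_prod,
      map_prod, map_prod]
    refine B.mul_mem (B.mul_mem ?_ (B.prod_mem fun j _ => ?_)) (B.pow_mem hinv j)
    · rw [← Polynomial.algebraMap_apply]
      exact B.algebraMap_mem r
    · rw [map_pow, map_pow, map_pow]
      exact B.pow_mem (hx j) _
  refine top_le_iff.mp fun P _ => ?_
  rw [P.as_sum_support_C_mul_X_pow]
  exact B.sum_mem fun i _ => B.mul_mem (hC _) (B.pow_mem hX i)

section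
include ha₀ hu hlam hA'

/-- **`L[s]` is integral over the Veronese subalgebra `A'`** (for `N' > 0` dividing `N`): the generators `s`, `1/u`,
`x̄ⱼ/1` of `L[s]` over `k` have their powers `s^{N'}`, `(1/u)^1`, `(x̄ⱼ/1)^{N'}` in `A'`, so `SubalgebraIntegralOfPow`
(p456170) applies. [folklore] -/
theorem isIntegral_veronese (hN' : 0 < N') (hdiv : (N : ZMod N') = 0) :
    Algebra.IsIntegral A' (Polynomial (Localization.Away u)) := by
  refine SubalgebraIntegralOfPow.stub_subalgebraIntegralOfPow k _ A' _ (adjoin_generators_eq_top f u) ?_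
  rintro s (hs | ⟨j, rfl⟩)
  · rcases hs with rfl | rfl
    · exact ⟨N', hN', X_pow_mem_veronese f u lam N' A' hA' N' (ZMod.natCast_self N')⟩
    · refine ⟨1, one_pos, ?_⟩
      rw [pow_one]
      refine C_mem_veronese_of_isHomogeneous f u lam N' A' hA' (coaction_invSelf w f u ha₀ hu lam hlam) ?_
      push_cast
      rw [hdiv, neg_zero]
  · refine ⟨N', hN', ?_⟩
    rw [← map_pow, ← map_pow, ← map_pow]
    refine C_mem_veronese_of_isHomogeneous f u lam N' A' hA' (d := ((N' * w j : ℕ) : ℤ)) ?_ ?_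
    · rw [hlam, Nat.cast_mul]
      have h := aeval_of_isWeightedHomogeneous w f u ((MvPolynomial.isWeightedHomogeneous_X k w j).pow N')
      rwa [smul_eq_mul, Nat.cast_mul] at h
    · push_cast
      rw [ZMod.natCast_self, zero_mul]

end

end Summit.ResolutionOfSingularities.ResolutionOfSingularities.Theorems.FInjectiveMacaulayfication.VeroneseSubalgebra

end
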